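import Summits.NavierStokesRegularity.NavierStokesRegularity.Theorems.PerpetualPumpCircuitPumpActiveCore
import Summits.NavierStokesRegularity.NavierStokesRegularity.Theorems.PerpetualPumpCircuitPumpActiveClock
import Summits.NavierStokesRegularity.NavierStokesRegularity.Theorems.PerpetualPumpCircuitPumpPrecursorSigned

/-!
# `PerpetualPump.CircuitPump` (stmt-NavierStokesRegularity-1834), line `singular-clock-gspt`:
# INTO for the Toda clock box — active block and precursor tower at a section time

Helper lemmas for the sub-goal `toda_into` of `stub_clockBox` (Toda `m = 2` instance): the active
block `n = 0, 1` of the `L`-truncated seeded graded Toda system is read off in the variables of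
`toda_active_core` (`u = a 0`, `v = b 0`, `w = a 1`, `z = b 1`, `e = b (-1)`, `y = a 2`); from its
outputs we extract the spent active pair (`|u| ≤ 13`, `v ≤ 31/A` after `t₃`) and, through the shifted
phase III clock `activeClock_star`, the sharp growth bound of the new bond
`log z(t) ≤ log ε + 28 log A + 448 + lam W⁺ (t - t₃)`; this yields the driver bound
`z ≤ ε^{9/20} A₂^{28} e^{548}` on a section window, under which `toda_precursor_tower` /
`toda_precursor_signed` are instantiated with `(α, β) = (ε², ε^{3/2})`. Pure real analysis. [folklore]
-/

set_option linter.dupNamespace false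

noncomputable section

open Set

namespace Summit.NavierStokesRegularity.NavierStokesRegularity.Theorems.PerpetualPumpCircuitPump

/-- The active block `n = 0, 1` of the Toda system in the variables of `toda_active_core`: continuity of
`a 0, b 0, a 1, b 1, b (-1), a 2` and the four active ODEs (`lam⁰ = 1`, `lam^{4/5} = ν`). [folklore] -/
theorem into_active_sys {lam ν ε S : ℝ} {L : ℕ} {a b : ℤ → ℝ → ℝ}
    (hν : ν = lam ^ (4 / 5 : ℝ)) (hL : 2 ≤ L)
    (hcont : ∀ n : ℤ, |n| ≤ (L : ℤ) → ContinuousOn (a n) (Icc 0 S) ∧ ContinuousOn (b n) (Icc 0 S))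
    (hderiv : ∀ n : ℤ, |n| ≤ (L : ℤ) → ∀ t ∈ Ico 0 S,
      HasDerivWithinAt (a n) (-(lam ^ ((4 / 5 : ℝ) * n)) * a n t - lam ^ (n : ℝ) * b n t ^ 2 +
        lam ^ ((n : ℝ) - 1) * b (n - 1) t ^ 2 - ε * lam ^ (n : ℝ) * a n t * b n t) (Ici t) t ∧
      HasDerivWithinAt (b n) (-(lam ^ ((4 / 5 : ℝ) * n)) * b n t +
        lam ^ (n : ℝ) * b n t * (a n t - a (n + 1) t) + ε * lam ^ (n : ℝ) * a n t ^ 2) (Ici t) t) :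
    ContinuousOn (a 0) (Icc 0 S) ∧ ContinuousOn (b 0) (Icc 0 S) ∧ ContinuousOn (a 1) (Icc 0 S) ∧
    ContinuousOn (b 1) (Icc 0 S) ∧ ContinuousOn (b (-1)) (Icc 0 S) ∧ ContinuousOn (a 2) (Icc 0 S) ∧
    (∀ t ∈ Ico 0 S, HasDerivWithinAt (a 0)
      (-a 0 t - b 0 t ^ 2 + lam⁻¹ * b (-1) t ^ 2 - ε * a 0 t * b 0 t) (Ici t) t) ∧
    (∀ t ∈ Ico 0 S, HasDerivWithinAt (b 0)
      (b 0 t * (a 0 t - a 1 t) - b 0 t + ε * a 0 t ^ 2) (Ici t) t) ∧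
    (∀ t ∈ Ico 0 S, HasDerivWithinAt (a 1)
      (-ν * a 1 t + b 0 t ^ 2 - lam * b 1 t ^ 2 - ε * lam * a 1 t * b 1 t) (Ici t) t) ∧
    (∀ t ∈ Ico 0 S, HasDerivWithinAt (b 1)
      (b 1 t * (lam * (a 1 t - a 2 t) - ν) + ε * lam * a 1 t ^ 2) (Ici t) t) := by
  have h0 : |(0 : ℤ)| ≤ (L : ℤ) := by simp
  have h1 : |(1 : ℤ)| ≤ (L : ℤ) := by simp; omega
  have hm1 : |(-1 : ℤ)| ≤ (L : ℤ) := by simp; omega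
  have h2 : |(2 : ℤ)| ≤ (L : ℤ) := by simp; omega
  have e1 : lam ^ ((0 : ℝ) - 1) = lam⁻¹ := by norm_num [Real.rpow_neg_one]
  have e2 : lam ^ ((4 / 5 : ℝ) * 1) = ν := by rw [mul_one, hν]
  refine ⟨(hcont 0 h0).1, (hcont 0 h0).2, (hcont 1 h1).1, (hcont 1 h1).2, (hcont (-1) hm1).2,
    (hcont 2 h2).1, ?_, ?_, ?_, ?_⟩
  · intro t ht
    refine ((hderiv 0 h0 t ht).1).congr_deriv ?_
    push_cast
    rw [e1]; norm_num
  · intro t ht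
    refine ((hderiv 0 h0 t ht).2).congr_deriv ?_
    push_cast
    norm_num; ring
  · intro t ht
    refine ((hderiv 1 h1 t ht).1).congr_deriv ?_
    push_cast
    rw [e2]; norm_num; ring
  · intro t ht
    refine ((hderiv 1 h1 t ht).2).congr_deriv ?_
    push_cast
    rw [e2]; norm_num; ring

/-- `V ≤ A e^{-(A/4)s} + 30/A` with `s ≥ 16 log A / A` gives `V ≤ 31/A` (`A ≥ 1`). [folklore] -/
theorem into_pt_v {A s V : ℝ} (hA : 1 ≤ A) (hs : 16 * Real.log A / A ≤ s)
    (hV : V ≤ A * Real.exp (-(A / 4) * s) + 30 / A) : V ≤ 31 / A := by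
  have hA0 : 0 < A := by linarith
  have hlogA : 0 ≤ Real.log A := Real.log_nonneg hA
  have h0 : A / 4 * (16 * Real.log A / A) = 4 * Real.log A := by field_simp; ring
  have h1 : -(A / 4) * s ≤ Real.log A * (-2 : ℝ) := by
    have := mul_le_mul_of_nonneg_left hs (by positivity : (0 : ℝ) ≤ A / 4)
    linarith
  have h2 : Real.exp (-(A / 4) * s) ≤ (A ^ 2)⁻¹ := by
    calc Real.exp (-(A / 4) * s) ≤ Real.exp (Real.log A * (-2 : ℝ)) := Real.exp_le_exp.mpr h1
      _ = (A ^ 2)⁻¹ := by rw [← Real.rpow_def_of_pos hA0, Real.rpow_neg hA0.le, Real.rpow_two]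
  have h3 : A * Real.exp (-(A / 4) * s) ≤ 1 / A := by
    calc A * Real.exp (-(A / 4) * s) ≤ A * (A ^ 2)⁻¹ := mul_le_mul_of_nonneg_left h2 hA0.le
      _ = 1 / A := by field_simp
  have h4 : 1 / A + 30 / A = 31 / A := by ring
  linarith

/-- Location of the gate radius: `τ⁻ ≤ tg ≤ τ⁺` and `|W - A e^{-tg}| ≤ E` give
`A - ℓ - 11/5 - E ≤ W ≤ A - ℓ + 6/5 + E`. [folklore] -/
theorem into_pt_W {A ℓ tg W E : ℝ} (hA : 0 < A) (hx : (ℓ + 11 / 5) / A < 1)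
    (h1 : -Real.log (1 - (ℓ - 6 / 5) / A) ≤ tg) (h2 : tg ≤ -Real.log (1 - (ℓ + 11 / 5) / A))
    (hW : |W - A * Real.exp (-tg)| ≤ E) :
    A - ℓ - 11 / 5 - E ≤ W ∧ W ≤ A - ℓ + 6 / 5 + E := by
  have hxp : 0 < 1 - (ℓ + 11 / 5) / A := by linarith
  have hxm : 0 < 1 - (ℓ - 6 / 5) / A := by
    have : (ℓ - 6 / 5) / A ≤ (ℓ + 11 / 5) / A := div_le_div_of_nonneg_right (by linarith) hA.le
    linarith
  have em : A * (1 - (ℓ - 6 / 5) / A) = A - ℓ + 6 / 5 := by field_simp; ring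
  have ep : A * (1 - (ℓ + 11 / 5) / A) = A - ℓ - 11 / 5 := by field_simp; ring
  have hup : A * Real.exp (-tg) ≤ A - ℓ + 6 / 5 := by
    calc A * Real.exp (-tg) ≤ A * Real.exp (Real.log (1 - (ℓ - 6 / 5) / A)) :=
          mul_le_mul_of_nonneg_left (Real.exp_le_exp.mpr (by linarith)) hA.le
      _ = A - ℓ + 6 / 5 := by rw [Real.exp_log hxm, em]
  have hlo : A - ℓ - 11 / 5 ≤ A * Real.exp (-tg) := by
    calc A - ℓ - 11 / 5 = A * Real.exp (Real.log (1 - (ℓ + 11 / 5) / A)) := by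
          rw [Real.exp_log hxp, ep]
      _ ≤ A * Real.exp (-tg) :=
          mul_le_mul_of_nonneg_left (Real.exp_le_exp.mpr (by linarith)) hA.le
  have hW' := abs_le.mp hW
  constructor <;> linarith

/-- **The active block at a section time.** `toda_active_core` applied to the active block of an
`L`-truncated Toda solution on `[0, S]` inside the corridor (`b 1 ≤ 1/4`, `0 ≤ b (-1) ≤ 1`, `|a 2| ≤ 1`),
followed by the shifted phase III clock `activeClock_star` with `W = R(t₃) ≤ W⁺(A)`: the spent active
pair obeys `-13 ≤ a 0` throughout and `|a 0| ≤ 13`, `b 0 ≤ 31/A` after `t₃`, and the new bond obeys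
`log b 1 (t) ≤ log ε + 28 log A + 448 + lam W⁺(A) (t - t₃)` on `[t₃, S]`. [folklore] -/
theorem into_core :
    ∀ (lam ν ε Λ A S t₃ : ℝ) (L : ℕ) (a b : ℤ → ℝ → ℝ), 1 < lam → lam ≤ 3 / 2 →
    ν = lam ^ (4 / 5 : ℝ) → 0 < ε → Λ = -Real.log ε → 0 < S → S ≤ 1 / 2 → 40000 ≤ A → Λ ≤ A / 5 →
    ε * (A + 2) ^ 2 ≤ 1 → Real.sqrt ε * A ≤ 1 / 40 →
    t₃ = -Real.log (1 - ((Λ / 2 + Real.log (A / 8)) + 11 / 5) / A) + (250 + 16 * Real.log A) / A →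
    0 < ((Λ / 2 + Real.log (A / 8)) + 11 / 5) / A → ((Λ / 2 + Real.log (A / 8)) + 11 / 5) / A < 1 →
    t₃ < S → 2 ≤ L → a 0 0 = A → b 0 0 = Real.sqrt ε → -ε ^ 2 ≤ a 1 0 → a 1 0 ≤ ε ^ (3 / 4 : ℝ) →
    0 ≤ b 1 0 → b 1 0 ≤ ε ^ (3 / 2 : ℝ) →
    (∀ n : ℤ, |n| ≤ (L : ℤ) → ContinuousOn (a n) (Set.Icc 0 S) ∧ ContinuousOn (b n) (Set.Icc 0 S)) →
    (∀ n : ℤ, |n| ≤ (L : ℤ) → ∀ t ∈ Set.Ico 0 S,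
      HasDerivWithinAt (a n) (-(lam ^ ((4 / 5 : ℝ) * n)) * a n t - lam ^ (n : ℝ) * b n t ^ 2 +
        lam ^ ((n : ℝ) - 1) * b (n - 1) t ^ 2 - ε * lam ^ (n : ℝ) * a n t * b n t) (Set.Ici t) t ∧
      HasDerivWithinAt (b n) (-(lam ^ ((4 / 5 : ℝ) * n)) * b n t +
        lam ^ (n : ℝ) * b n t * (a n t - a (n + 1) t) + ε * lam ^ (n : ℝ) * a n t ^ 2) (Set.Ici t) t) →
    (∀ t ∈ Set.Icc 0 S, b 1 t ≤ 1 / 4 ∧ b (-1) t ≤ 1 ∧ |a 2 t| ≤ 1) →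
    (∀ t ∈ Set.Icc 0 S, 0 ≤ b (-1) t) →
    0 ≤ t₃ ∧ (∀ t ∈ Set.Icc 0 S, -13 ≤ a 0 t) ∧ (∀ t ∈ Set.Icc t₃ S, |a 0 t| ≤ 13 ∧ b 0 t ≤ 31 / A) ∧
    (∀ t ∈ Set.Icc t₃ S, 0 < b 1 t ∧ Real.log (b 1 t) ≤ Real.log ε + 28 * Real.log A + 448 +
      lam * (A - (Λ / 2 + Real.log (A / 8)) + 903 + 50 * Real.log A) * (t - t₃)) := by
  intro lam ν ε Λ A S t₃ L a b hlam hlam2 hν hε hΛ hS hS2 hA hΛA hεA hsA ht₃ hx0 hx1 ht₃S hL ha00 hb00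
    ha10 ha10' hb10 hb10' hcont hderiv henv hbm1
  subst hΛ
  obtain ⟨hua, hva, hwa, hza, hea, hya, hu', hv', hw', hz'⟩ := into_active_sys hν hL hcont hderiv
  have hA0 : 0 < A := by linarith
  have hA1 : 1 ≤ A := by linarith
  have hlam0 : 0 < lam := by linarith
  have hν0 : 0 < ν := by rw [hν]; positivity
  have hlogA : 0 ≤ Real.log A := Real.log_nonneg hA1
  have hτp0 : 0 ≤ -Real.log (1 - ((-Real.log ε / 2 + Real.log (A / 8)) + 11 / 5) / A) := by
    rw [neg_nonneg]; exact Real.log_nonpos (by linarith) (by linarith)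
  have h16 : 0 ≤ 16 * Real.log A / A := by positivity
  have h250 : 0 ≤ 250 / A := by positivity
  have hJ : t₃ - (-Real.log (1 - ((-Real.log ε / 2 + Real.log (A / 8)) + 11 / 5) / A) + 250 / A) =
      16 * Real.log A / A := by rw [ht₃]; ring
  have ht₃0 : 0 ≤ t₃ := by linarith
  obtain ⟨hI, ⟨tg, htgm, htgp, -, -, hIII, hIV⟩, hV, hz3, hzlo, hzhi⟩ :=
    toda_active_core lam ν ε A S (a 0) (b 0) (a 1) (b 1) (b (-1)) (a 2) hlam hlam2 hν hε hS hS2 hA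
      hΛA hεA hsA (by rw [← ht₃]; exact ht₃S.le) ha00 hb00 ha10 ha10' hb10 hb10' hua hva hwa hza
      hea hya hu' hv' hw' hz' (fun t ht => ⟨hbm1 t ht, (henv t ht).2.1⟩)
      (fun t ht => (henv t ht).2.2) (fun t ht => (henv t ht).1.trans (by norm_num))
  rw [← ht₃] at hIV hV hz3 hzlo hzhi
  set W := Real.sqrt ((a 0 t₃ - a 1 t₃) ^ 2 + 2 * b 0 t₃ ^ 2) with hW
  obtain ⟨hWlo, hWhi⟩ := into_pt_W (ℓ := -Real.log ε / 2 + Real.log (A / 8)) hA0 hx1 htgm htgp hIV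
  have hWabs : |W - (A - (-(Real.log ε) / 2 + Real.log (A / 8)))| ≤ 903 + 50 * Real.log A := by
    rw [abs_le]; constructor <;> linarith
  obtain ⟨-, -, -, hWm, hWmW, hWWp, hWp⟩ := activeClock_W hε hA hΛA hεA hWabs
  have hW0 : 0 < W := by linarith
  have hW30 : W + 30 ≤ 21 * A / 20 := by linarith
  have hsub : Icc t₃ S ⊆ Icc 0 S := Icc_subset_Icc_left ht₃0
  have star := activeClock_star hlam hlam2 hν hε hA ht₃S (by linarith) hW0 hW30 (hwa.mono hsub)
    (hza.mono hsub) (hya.mono hsub) (fun t ht => hz' t ⟨ht₃0.trans ht.1, ht.2⟩)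
    (fun t ht => (hV t ht).1) (fun t ht => (henv t (hsub ht)).2.2) hz3 hzlo
  refine ⟨ht₃0, fun t ht => (hI t ht).2.2.1, fun t ht => ⟨(hV t ht).2.2, ?_⟩, fun t ht => ?_⟩
  · have ht' : t ∈ Icc (-Real.log (1 - ((-Real.log ε / 2 + Real.log (A / 8)) + 11 / 5) / A) +
        250 / A) S := ⟨by linarith [ht.1], ht.2⟩
    exact into_pt_v hA1 (by linarith [ht.1]) (hIII t ht').2
  · obtain ⟨hzt, -, hhi⟩ := star t ht
    have he := Real.add_one_le_exp (-ν * (t - t₃))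
    have hlamW : 0 ≤ lam * W := by positivity
    have hs0 : 0 ≤ t - t₃ := by linarith [ht.1]
    have hG : lam * W * (1 - Real.exp (-ν * (t - t₃))) / ν ≤ lam * W * (t - t₃) := by
      rw [div_le_iff₀ hν0]
      calc lam * W * (1 - Real.exp (-ν * (t - t₃))) ≤ lam * W * (ν * (t - t₃)) :=
            mul_le_mul_of_nonneg_left (by linarith) hlamW
        _ = lam * W * (t - t₃) * ν := by ring
    have hWs : lam * W * (t - t₃) ≤
        lam * (A - (-Real.log ε / 2 + Real.log (A / 8)) + 903 + 50 * Real.log A) * (t - t₃) :=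
      mul_le_mul_of_nonneg_right (mul_le_mul_of_nonneg_left hWWp hlam0.le) hs0
    exact ⟨hzt, by linarith⟩

/-- **Driver bound.** On a section window `[0, T]` with `T - t₃ ≤ Δ⁺`, the new bond stays below
`Zs = ε^{9/20} A₂^{28} e^{548}`: before `t₃` by the pre-gate sup `ε A^{27} e^{400}`, after `t₃` by the
clock bound of `into_core` and the window fact `lam W⁺ Δ⁺ ≤ (11/20) Λ + 100`. [folklore] -/
theorem into_driver {ε Λ A A₂ T t₃ lW Δp Zs : ℝ} {z : ℝ → ℝ} (hε : 0 < ε) (hε1 : ε ≤ 1)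
    (hΛ : Λ = -Real.log ε) (hA : 1 ≤ A) (hAA₂ : A ≤ A₂)
    (hZs : Zs = ε ^ (9 / 20 : ℝ) * A₂ ^ 28 * Real.exp 548)
    (hpre : ∀ t ∈ Icc 0 T, t ≤ t₃ → z t ≤ ε * A ^ 27 * Real.exp 400)
    (hpost : ∀ t ∈ Icc t₃ T, 0 < z t ∧
      Real.log (z t) ≤ Real.log ε + 28 * Real.log A + 448 + lW * (t - t₃))
    (hWΔ : lW * Δp ≤ 11 / 20 * Λ + 100) (hTΔ : T - t₃ ≤ Δp) (hlW : 0 ≤ lW) :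
    ∀ t ∈ Icc 0 T, z t ≤ Zs := by
  intro t ht
  have hA0 : 0 < A := by linarith
  have hA₂1 : 1 ≤ A₂ := hA.trans hAA₂
  have h27 : A ^ 27 ≤ A₂ ^ 28 := by
    calc A ^ 27 ≤ A₂ ^ 27 := pow_le_pow_left₀ hA0.le hAA₂ 27
      _ ≤ A₂ ^ 28 := pow_le_pow_right₀ hA₂1 (by norm_num)
  have hε920 : ε ≤ ε ^ (9 / 20 : ℝ) := by
    calc ε = ε ^ (1 : ℝ) := (Real.rpow_one ε).symm
      _ ≤ ε ^ (9 / 20 : ℝ) := Real.rpow_le_rpow_of_exponent_ge hε hε1 (by norm_num)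
  rcases le_or_gt t t₃ with hle | hlt
  · calc z t ≤ ε * A ^ 27 * Real.exp 400 := hpre t ht hle
      _ ≤ ε ^ (9 / 20 : ℝ) * A₂ ^ 28 * Real.exp 548 :=
          mul_le_mul (mul_le_mul hε920 h27 (by positivity) (by positivity))
            (Real.exp_le_exp.mpr (by norm_num)) (by positivity) (by positivity)
      _ = Zs := hZs.symm
  · obtain ⟨hzt, hlog⟩ := hpost t ⟨hlt.le, ht.2⟩
    have h1 : lW * (t - t₃) ≤ lW * Δp := mul_le_mul_of_nonneg_left (by linarith [ht.2]) hlW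
    have h2 : Real.log (z t) ≤ Real.log ε * (9 / 20 : ℝ) + Real.log (A ^ 28) + 548 := by
      rw [Real.log_pow, hΛ] at *; push_cast at *; linarith
    calc z t = Real.exp (Real.log (z t)) := (Real.exp_log hzt).symm
      _ ≤ Real.exp (Real.log ε * (9 / 20 : ℝ) + Real.log (A ^ 28) + 548) := Real.exp_le_exp.mpr h2
      _ = ε ^ (9 / 20 : ℝ) * A ^ 28 * Real.exp 548 := by
          rw [Real.exp_add, Real.exp_add, ← Real.rpow_def_of_pos hε, Real.exp_log (by positivity)]
      _ ≤ Zs := by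
          rw [hZs]
          exact mul_le_mul_of_nonneg_right (mul_le_mul_of_nonneg_left
            (pow_le_pow_left₀ hA0.le hAA₂ 28) (by positivity)) (by positivity)

/-- **The precursor tower at a section time.** `toda_precursor_tower` and `toda_precursor_signed` on
`[0, T]` (restricted from `[0, Tmax]`) with `(α, β, Zb) = (ε², ε^{3/2}, Zs)` and
`M = ε² + 4 lam³ Zs² T`; the side conditions `M ≤ 2/5`, `18 ε M² ≤ β`, `28 β² T ≤ M` follow from
`18 ε (ε² + 4 lam³ Zs² Tmax)² ≤ ε^{3/2}` and `ε ≤ 10⁻⁵`. [folklore] -/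
theorem into_tower {lam ε T Tmax Zs : ℝ} {L : ℕ} {a b : ℤ → ℝ → ℝ} (hlam : 1 < lam)
    (hlam2 : lam ≤ 2) (hε : 0 < ε) (hε1 : ε ≤ 1 / 100000) (hT : 0 < T) (hTT : T ≤ Tmax)
    (hTmax : Tmax ≤ 1 / 8) (hZs : 0 ≤ Zs)
    (HS7 : 18 * ε * (ε ^ 2 + 4 * lam ^ 3 * Zs ^ 2 * Tmax) ^ 2 ≤ ε ^ (3 / 2 : ℝ))
    (hzero : ∀ n : ℤ, (L : ℤ) < |n| → ∀ t ∈ Icc 0 Tmax, a n t = 0 ∧ b n t = 0)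
    (hcont : ∀ n : ℤ, |n| ≤ (L : ℤ) →
      ContinuousOn (a n) (Icc 0 Tmax) ∧ ContinuousOn (b n) (Icc 0 Tmax))
    (hderiv : ∀ n : ℤ, |n| ≤ (L : ℤ) → ∀ t ∈ Ico 0 Tmax,
      HasDerivWithinAt (a n) (-(lam ^ ((4 / 5 : ℝ) * n)) * a n t - lam ^ (n : ℝ) * b n t ^ 2 +
        lam ^ ((n : ℝ) - 1) * b (n - 1) t ^ 2 - ε * lam ^ (n : ℝ) * a n t * b n t) (Ici t) t ∧
      HasDerivWithinAt (b n) (-(lam ^ ((4 / 5 : ℝ) * n)) * b n t +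
        lam ^ (n : ℝ) * b n t * (a n t - a (n + 1) t) + ε * lam ^ (n : ℝ) * a n t ^ 2) (Ici t) t)
    (hb0 : ∀ n : ℤ, 0 ≤ b n 0) (hdrive : ∀ t ∈ Icc 0 T, b 1 t ≤ Zs)
    (hpre : ∀ n : ℤ, 2 ≤ n → |a n 0| ≤ ε ^ 2 * (2 * lam) ^ (-(n : ℝ)) ∧
      b n 0 ≤ ε ^ (3 / 2 : ℝ) * (2 * lam) ^ (-(n : ℝ))) :
    ∀ n : ℤ, 2 ≤ n → 0 ≤ b n T ∧
      b n T ≤ max (b n 0) (ε ^ (3 / 2 : ℝ) * lam ^ ((n : ℝ) / 5) * (2 * lam) ^ (-(2 * (n : ℝ)))) ∧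
      |a n T| ≤ |a n 0| + (if n = 2 then lam * Zs ^ 2 * T else 0) +
        28 * ε ^ 3 * (2 * lam) ^ (-(n : ℝ)) * T ∧
      -|a n 0| - 28 * ε ^ 3 * (2 * lam) ^ (-(n : ℝ)) * T ≤ a n T := by
  intro n hn
  have hlam0 : 0 < lam := by linarith
  have hε1' : ε ≤ 1 := by linarith
  set M := ε ^ 2 + 4 * lam ^ 3 * Zs ^ 2 * T with hM
  have hK0 : 0 ≤ 4 * lam ^ 3 * Zs ^ 2 := by positivity
  have hε2 : 0 < ε ^ 2 := by positivity
  have hM0 : 0 < M := by rw [hM]; nlinarith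
  have hMmax : M ≤ ε ^ 2 + 4 * lam ^ 3 * Zs ^ 2 * Tmax := by rw [hM]; nlinarith
  have hβM : 18 * ε * M ^ 2 ≤ ε ^ (3 / 2 : ℝ) :=
    (mul_le_mul_of_nonneg_left (pow_le_pow_left₀ hM0.le hMmax 2) (by positivity)).trans HS7
  have hβ1 : ε ^ (3 / 2 : ℝ) ≤ 1 := Real.rpow_le_one hε.le hε1' (by norm_num)
  have hβε : ε ^ (3 / 2 : ℝ) ≤ ε := by
    calc ε ^ (3 / 2 : ℝ) ≤ ε ^ (1 : ℝ) := Real.rpow_le_rpow_of_exponent_ge hε hε1' (by norm_num)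
      _ = ε := Real.rpow_one ε
  have h18 : 18 * M ^ 2 ≤ 1 :=
    le_of_mul_le_mul_left (by linarith : ε * (18 * M ^ 2) ≤ ε * 1) hε
  have hM25 : M ≤ 2 / 5 := by nlinarith
  have hβ2 : (ε ^ (3 / 2 : ℝ)) ^ 2 = ε ^ 3 := by
    rw [← Real.rpow_natCast, ← Real.rpow_mul hε.le]; norm_num
  have h28 : 28 * ε * T ≤ 1 := by nlinarith
  have hβT : 28 * (ε ^ (3 / 2 : ℝ)) ^ 2 * T ≤ M := by
    rw [hβ2]
    calc 28 * ε ^ 3 * T = ε ^ 2 * (28 * ε * T) := by ring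
      _ ≤ ε ^ 2 * 1 := mul_le_mul_of_nonneg_left h28 hε2.le
      _ ≤ M := by rw [hM, mul_one]; nlinarith
  have hTTm : Icc 0 T ⊆ Icc 0 Tmax := Icc_subset_Icc_right hTT
  have hzero' : ∀ n : ℤ, (L : ℤ) < |n| → ∀ t ∈ Icc 0 T, a n t = 0 ∧ b n t = 0 :=
    fun n hn t ht => hzero n hn t (hTTm ht)
  have hcont' : ∀ n : ℤ, |n| ≤ (L : ℤ) → ContinuousOn (a n) (Icc 0 T) ∧ ContinuousOn (b n) (Icc 0 T) :=
    fun n hn => ⟨(hcont n hn).1.mono hTTm, (hcont n hn).2.mono hTTm⟩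
  have hderiv' : ∀ n : ℤ, |n| ≤ (L : ℤ) → ∀ t ∈ Ico 0 T,
      HasDerivWithinAt (a n) (-(lam ^ ((4 / 5 : ℝ) * n)) * a n t - lam ^ (n : ℝ) * b n t ^ 2 +
        lam ^ ((n : ℝ) - 1) * b (n - 1) t ^ 2 - ε * lam ^ (n : ℝ) * a n t * b n t) (Ici t) t ∧
      HasDerivWithinAt (b n) (-(lam ^ ((4 / 5 : ℝ) * n)) * b n t +
        lam ^ (n : ℝ) * b n t * (a n t - a (n + 1) t) + ε * lam ^ (n : ℝ) * a n t ^ 2) (Ici t) t :=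
    fun n hn t ht => hderiv n hn t ⟨ht.1, ht.2.trans_le hTT⟩
  obtain ⟨hb0T, hbmax, -, haT⟩ := toda_precursor_tower lam ε T (ε ^ 2) (ε ^ (3 / 2 : ℝ)) Zs M L
    a b hlam hlam2 hε.le hε1' hT (by linarith) hε2.le (by positivity) hβ1 hZs hM hM0 hM25 hβM hβT
    hzero' hcont' hderiv' hb0 hdrive hpre T ⟨hT.le, le_rfl⟩ n hn
  have hsig := toda_precursor_signed lam ε T (ε ^ 2) (ε ^ (3 / 2 : ℝ)) Zs M L a b hlam hlam2
    hε.le hε1' hT (by linarith) hε2.le (by positivity) hβ1 hZs hM hM0 hM25 hβM hβT hzero' hcont'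
    hderiv' hb0 hdrive hpre T ⟨hT.le, le_rfl⟩ n hn
  rw [hβ2] at haT hsig
  refine ⟨hb0T, hbmax.trans (max_le_max le_rfl ?_), haT, hsig⟩
  exact mul_le_mul_of_nonneg_right (mul_le_mul_of_nonneg_right hβM (by positivity)) (by positivity)

end Summit.NavierStokesRegularity.NavierStokesRegularity.Theorems.PerpetualPumpCircuitPump
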